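import Mathlib
import Literature.Barriers.ValiantsHypothesis.AlgebraicNaturalProofs
import HarnessLib

/-!
# Crux `BarrierLever.SuccinctHittingSetsForVP` (stmt-ValiantsHypothesis-14610), line `registered` —
LAGRANGE INDICATORS OF THE GRID `{0, …, n} ⊂ ℂ` (registered stub `stub_lagrangeIndicator`)

**What is proved (it does NOT close the item).** The registered stub `stub_lagrangeIndicator` of the
skeleton `Cruxes/SuccinctHittingSetsForVP/Lines/birth.lean`: for every `n : ℕ` there is a family of
univariate polynomials `ℓ : ℕ → Polynomial ℂ` with `(ℓ k).eval k' = [k = k']` for all `k, k' ≤ n`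
(the values of `ℓ k` for `k > n` are unconstrained).

**Why.** The succinct Shpilka–Volkovich generator (Forbes–Shpilka–Volk 2018, Construction 25) in the
tree's regime `d = n` indexes coefficient coordinates by exponent vectors `μ ∈ {0, …, n}^n` and needs
indicator polynomials `L_μ(z) = ∏ᵢ ℓ_{μᵢ}(zᵢ)` with `L_μ(ν) = [μ = ν]` on grid points; these are
assembled (by the neighbour glue stub) from the univariate Lagrange basis of the node set
`{0, 1, …, n} ⊂ ℂ` provided here.

Mechanism: `ℓ k := Lagrange.basis (Finset.range (n + 1)) (Nat.cast : ℕ → ℂ) k` (Mathlib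
`Mathlib/LinearAlgebra/Lagrange.lean`); the cast `ℕ → ℂ` is injective (characteristic zero), so
`Lagrange.eval_basis_self` gives the diagonal value `1` and `Lagrange.eval_basis_of_ne` the
off-diagonal value `0`. Axioms: `propext`, `Classical.choice`, `Quot.sound`.
References: [ForbesShpilkaVolk2018] Construction 25; folklore (Lagrange interpolation).
-/

-- layout Summits/ValiantsHypothesis/ValiantsHypothesis forces the duplicated namespace component
set_option linter.dupNamespace false

namespace Summit.ValiantsHypothesis.ValiantsHypothesis.Theorems.BarrierLever.SuccinctHittingSetsForVP

open Literature.Barriers.ValiantsHypothesis Literature.Computability.AlgebraicComplexity MvPolynomial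

namespace LagrangeIndicator

/-- The Lagrange basis polynomial of the node set `{0, …, n} ⊂ ℂ` attached to the node `k` takes the
value `1` at `k`, provided `k ≤ n`. [folklore] -/
theorem eval_self {n k : ℕ} (hk : k ≤ n) :
    (Lagrange.basis (Finset.range (n + 1)) (fun m : ℕ => (m : ℂ)) k).eval (k : ℂ) = 1 :=
  Lagrange.eval_basis_self (v := fun m : ℕ => (m : ℂ)) (Nat.cast_injective.injOn)
    (Finset.mem_range.mpr (Nat.lt_succ_of_le hk))

/-- The Lagrange basis polynomial of the node set `{0, …, n} ⊂ ℂ` attached to the node `k` vanishes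
at every other node `k' ≤ n`, `k' ≠ k`. [folklore] -/
theorem eval_of_ne {n k k' : ℕ} (hkk' : k ≠ k') (hk' : k' ≤ n) :
    (Lagrange.basis (Finset.range (n + 1)) (fun m : ℕ => (m : ℂ)) k).eval (k' : ℂ) = 0 :=
  Lagrange.eval_basis_of_ne (v := fun m : ℕ => (m : ℂ)) hkk'
    (Finset.mem_range.mpr (Nat.lt_succ_of_le hk'))

end LagrangeIndicator

/-- **Registered stub `stub_lagrangeIndicator`** (crux stmt-ValiantsHypothesis-14610, line
`registered`; Lagrange indicators of the grid `{0, …, n} ⊂ ℂ`): for every `n` there are univariate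
polynomials `ℓ k` with `(ℓ k).eval k' = [k = k']` for all `k, k' ≤ n` — the univariate Lagrange basis
of the nodes `0, 1, …, n`, as used by the succinct Shpilka–Volkovich generator.
[cite: ForbesShpilkaVolk2018, Construction 25] [folklore] -/
theorem stub_lagrangeIndicator :
    ∀ n : ℕ, ∃ ℓ : ℕ → Polynomial ℂ,
      ∀ k k' : ℕ, k ≤ n → k' ≤ n → (ℓ k).eval (k' : ℂ) = if k = k' then 1 else 0 := by
  intro n
  refine ⟨fun k => Lagrange.basis (Finset.range (n + 1)) (fun m : ℕ => (m : ℂ)) k, ?_⟩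
  intro k k' hk hk'
  by_cases h : k = k'
  · subst h
    rw [if_pos rfl]
    exact LagrangeIndicator.eval_self hk
  · rw [if_neg h]
    exact LagrangeIndicator.eval_of_ne h hk'

end Summit.ValiantsHypothesis.ValiantsHypothesis.Theorems.BarrierLever.SuccinctHittingSetsForVP
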